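import Summits.BirchSwinnertonDyer.BirchSwinnertonDyer.Theorems.EisensteinPrimesLinePsiAtMultiplicativePrime
import Summits.BirchSwinnertonDyer.Rank1Residual.X2.IsogenyLineType
import Summits.BirchSwinnertonDyer.BirchSwinnertonDyer.Theorems.EisensteinPrimesResidualLineRigidity
import HarnessLib

/-!
# Crux 3 `MazurMCOnCellB` (stmt-BirchSwinnertonDyer-19033), line `twistback` v4 — brick (F3), sequel:
# at an odd multiplicative prime `p`, the character `φ` of an UNRAMIFIED rational line takes the
# value `φ(p) = a_p(E) ∈ {±1}`

Width seat bsd-line-x2-p1-w7 (g0); sequel to `…EisensteinPrimesLinePsiAtMultiplicativePrime` (the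
RAMIFIED line's quotient character `ψ`). HONEST FRAMING (cell `bsd-eis`,
run/shared/lean/pub/bsd-eis/): TOOL THEOREMS ONLY (no `def`, no named fact, no `sorry`); every input
is a tree THEOREM (Tate uniformisation DISCHARGED: `TateCurve.Silverman1994_thmV53_tateUniformisation_holds`,
`TateCurve.Silverman1994_thmV53_corV54_tateUniformisation_holds`); nothing is booked; no main
conjecture / BSD is proved for any curve; no summit statement is proved; 0 cells / labels move.

WHY. In Greenberg–Vatsal's reduction `E' = E/Φ` (Invent. Math. 142 (2000), p. 28) the two members
of the `p`-isogeny class carry the ramified-even and the unramified-odd line respectively; the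
twist-character dictionary of the line (LEAD g10's bricks (F1)/(F2), the X2b curve `W` itself when
its line is unramified) wants the value AT `p` of the character `φ` of an UNRAMIFIED rational line
`Φ₀ ≤ E[p]` (`hφ0` shape `σ • P = φ(χ_m σ) • P`, `φ` mod `m`, `p ∤ m`): since `Φ₀ ∩ C[p] = 0`
(the Tate line `C[p]` is moved by inertia), `Φ₀` maps isomorphically onto the unramified Tate
quotient `D[p]`, on which Frobenius acts by `a_p(E)` (GV §2 pp. 14–15). So **`φ(p) = a_p(E)`**:

* §1 `exists_tateLine_adicCompletionPrime_of_mem` — the Tate line at `𝔓₀ = adicCompletionPrime ℚ v`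
  WITH a point moved by `I_{𝔓₀}` (the X2 cell's `IsogenyLineType.exists_line_adicCompletionPrime_of_datum`
  on the Tate data packages `exists_data_of_split` / `exists_data_of_not_split`, at the GIVEN place;
  `IsogenyLineType.exists_tateLine_adicCompletionPrime` hides the prime behind an `∃`);
  `eq_of_quot_trivial_of_moved` — the line with inertially trivial quotient is unique;
  `natCast_eq_intCast_of_smul_eq_on_line` (two scalars by which one `σ` acts ON a line agree in
  `𝔽_p`; the non-zero point from `ResidualLineRigidity.exists_ne_zero_mem`);
* §2 **`phi_natCast_eq_neg_one_of_not_split_of_lineUnramifiedAt`** (NON-split odd `p`: `φ(p) = −1`;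
  a local Frobenius acts as `−1` on `E[p]/C[p]` by `CongruentPartnerTrace.exists_line_of_not_split`,
  and `res τ • P + P ∈ Φ₀ ⊓ C[p] = 0` on `Φ₀`) and **`phi_natCast_eq_one_of_split_of_lineUnramifiedAt`**
  (SPLIT odd `p`: `φ(p) = 1`; `TateLineDecomposition.fix_or_quot_of_split`, the second alternative
  being absurd for an unramified line).

References: [GreenbergVatsal2000] §2 pp. 14–15, 26, 28; [SilvermanATAEC1994] Ch. V Lemma 5.2 (c),
Thm. 5.3, Cor. 5.4; [NeukirchANT1999] Ch. I §10 (10.3), Ch. II §9 Prop. (9.6).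
-/

set_option autoImplicit false
set_option linter.dupNamespace false

noncomputable section

open scoped Classical Pointwise

open NumberField IsDedekindDomain Field WeierstrassCurve
  Literature.NumberTheory.EllipticCurves Literature.NumberTheory.GaloisRepresentations
  Literature.NumberTheory.EllipticCurves.GreenbergSelmer
  Literature.NumberTheory.EllipticCurves.Rank1Residual
  Summit.BirchSwinnertonDyer.Rank1Residual.X2.GreenbergVatsalTateDatum
  Summit.BirchSwinnertonDyer.Rank1Residual.X2.GreenbergVatsalTateDatumSign
  Summit.BirchSwinnertonDyer.Rank1Residual.X2.GreenbergVatsalTateFrobeniusSign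
  Summit.BirchSwinnertonDyer.Rank1Residual.X2
  Summit.BirchSwinnertonDyer.BirchSwinnertonDyer.Theorems.EisensteinPrimesLinePsiAtMultiplicativePrime

namespace Summit.BirchSwinnertonDyer.BirchSwinnertonDyer.Theorems.EisensteinPrimesLinePhiAtMultiplicativePrime

variable {W : WeierstrassCurve ℚ} [W.IsElliptic] {p : ℕ} [hp : Fact p.Prime]

/-! ## §1. The Tate line at the given place, with a moved point; algebra on a line -/

/-- **The Tate line at `𝔓₀ = adicCompletionPrime ℚ v`, with a moved point** (`p` odd
multiplicative, either sign): a line `L ≤ E[p]` of order `p` with `(σ − 1)E[p] ⊆ L` for every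
`σ ∈ I_{𝔓₀}` and some `σ ∈ I_{𝔓₀}` moving a point of `L` — `IsogenyLineType.exists_line_adicCompletionPrime_of_datum`
on the Tate data packages `exists_data_of_split` / `exists_data_of_not_split`, at the GIVEN place `v`
(the tree's `IsogenyLineType.exists_tateLine_adicCompletionPrime` hides the prime behind an `∃`).
Inputs: the two Tate uniformisation facts, DISCHARGED in the tree. [cite: GreenbergVatsal2000, §2 pp. 14–15 and p. 26]
[cite: SilvermanATAEC1994, Ch. V Lemma 5.2 (c), Thm. 5.3 (a),(b), Cor. 5.4 (held copy PDF pp. 406–410)] -/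
theorem exists_tateLine_adicCompletionPrime_of_mem [W.IsGloballyMinimal] (hp2 : p ≠ 2)
    (hmult : W.HasMultiplicativeReductionAtPrime p) {v : HeightOneSpectrum (𝓞 ℚ)}
    (hpv : ((p : ℕ) : 𝓞 ℚ) ∈ v.asIdeal) :
    ∃ L : AddSubgroup (geomTorsion W (p : ℤ)), Nat.card L = p ∧
      (∀ σ ∈ (adicCompletionPrime ℚ v).inertia (absoluteGaloisGroup ℚ),
        ∀ P : geomTorsion W (p : ℤ), σ • P - P ∈ L) ∧
      (∃ σ ∈ (adicCompletionPrime ℚ v).inertia (absoluteGaloisGroup ℚ), ∃ P ∈ L, σ • P ≠ P) := by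
  obtain ⟨κ, hκ, -⟩ := exists_isCyclotomic_isTopGenerator_isCyclotomicVariable_holds p
  by_cases hsplit : W.HasSplitMultiplicativeReductionAtPrime p
  · obtain ⟨Ld, htriv, hgen, hC, -⟩ := GreenbergVatsalTateDatumCofree.exists_data_of_split W p κ
      TateCurve.Silverman1994_thmV53_tateUniformisation_holds hp2 hsplit
    exact IsogenyLineType.exists_line_adicCompletionPrime_of_datum W p hpv (Ld v hpv) (htriv v hpv)
      (hgen v hpv) (hC v hpv).2
  · obtain ⟨Ld, htriv, hgen, hC, -⟩ := GreenbergVatsalTateDatumCofree.exists_data_of_not_split W p κ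
      TateCurve.Silverman1994_thmV53_corV54_tateUniformisation_holds hκ hp2 hmult hsplit
    exact IsogenyLineType.exists_line_adicCompletionPrime_of_datum W p hpv (Ld v hpv) (htriv v hpv)
      (hgen v hpv) (hC v hpv).2

omit [W.IsElliptic] in
/-- **The line with inertially trivial quotient is unique**: if a subgroup `I ≤ Γ_ℚ` acts
trivially on `E[p]/X` and on `E[p]/L` (`#X = #L = p`) and some element of `I` moves a point of
`E[p]`, then `X = L` (else `X ⊓ L = ⊥` would contain `σ • P − P ≠ 0`). [folklore] -/
theorem eq_of_quot_trivial_of_moved {X L : AddSubgroup (geomTorsion W (p : ℤ))}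
    (hX : Nat.card X = p) (hL : Nat.card L = p) {I : Subgroup (absoluteGaloisGroup ℚ)}
    (hXI : ∀ σ ∈ I, ∀ P : geomTorsion W (p : ℤ), σ • P - P ∈ X)
    (hLI : ∀ σ ∈ I, ∀ P : geomTorsion W (p : ℤ), σ • P - P ∈ L)
    (hmoved : ∃ σ ∈ I, ∃ P : geomTorsion W (p : ℤ), σ • P ≠ P) : X = L := by
  rcases TateLineDecomposition.inf_eq_bot_or_eq W p hX hL with hbot | heq
  · exfalso
    obtain ⟨σ, hσ, P, hne⟩ := hmoved
    have h1 : σ • P - P ∈ (X ⊓ L : AddSubgroup _) := ⟨hXI σ hσ P, hLI σ hσ P⟩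
    rw [hbot, AddSubgroup.mem_bot, sub_eq_zero] at h1
    exact hne h1
  · exact heq

omit [W.IsElliptic] in
/-- If `σ` acts on a line `Φ` (`#Φ = p`) both as the natural number `n` and as the integer `s`,
then `n = s` in `𝔽_p` (a non-zero point of `Φ` has order `p`). [folklore] -/
theorem natCast_eq_intCast_of_smul_eq_on_line {Φ : AddSubgroup (geomTorsion W (p : ℤ))}
    (hΦ : Nat.card Φ = p) {σ : absoluteGaloisGroup ℚ} {s : ℤ} {n : ℕ}
    (hs : ∀ P ∈ Φ, σ • P = s • P) (hn : ∀ P ∈ Φ, σ • P = n • P) :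
    (n : ZMod p) = (s : ZMod p) := by
  obtain ⟨P, hP, hP0⟩ := ResidualLineRigidity.exists_ne_zero_mem hΦ
  have hord : addOrderOf P = p :=
    addOrderOf_eq_prime (AddSubgroup.torsionBy.nsmul P) hP0
  have hk : (s - (n : ℤ)) • P = 0 := by
    rw [sub_zsmul, natCast_zsmul, ← hs P hP, ← hn P hP]
    exact sub_self _
  have hdvd : (p : ℤ) ∣ s - (n : ℤ) := by
    rw [← hord]
    exact (addOrderOf_dvd_iff_zsmul_eq_zero).mpr hk
  have h0 : ((s - (n : ℤ) : ℤ) : ZMod p) = 0 := (ZMod.intCast_zmod_eq_zero_iff_dvd _ p).mpr hdvd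
  rw [Int.cast_sub, Int.cast_natCast, sub_eq_zero] at h0
  exact h0.symm

/-! ## §2. `φ(p) = a_p(E)` for an UNRAMIFIED rational line -/

/-- **NON-SPLIT, UNRAMIFIED line: `φ(p) = −1`.** Let `E = W/ℚ` be globally minimal with
non-split multiplicative reduction at the odd prime `p`, `Φ₀ ≤ E[p]` a rational line UNRAMIFIED at
`p`, on which `Γ_ℚ` acts through a Dirichlet character `φ` mod `m`, `p ∤ m`
(`σ • P = φ(χ_m σ) • P`, the `hφ0` shape). Then `φ(p) = −1`: `Φ₀` meets the Tate line `C[p]`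
trivially (`C[p]` has a point moved by inertia), so a local Frobenius `τ`, which acts as `−1` on
`E[p]/C[p]`, satisfies `res τ • P + P ∈ Φ₀ ⊓ C[p] = 0` on `Φ₀`, while `res τ • P = φ(p) • P`.
This is the other member of the isogeny class in Greenberg–Vatsal's reduction `E' = E/Φ`
(p. 28): the kernel character of an unramified line at a non-split `p` is the unramified
quadratic character times nothing. [cite: GreenbergVatsal2000, §2 pp. 14–15 and p. 28]
[cite: SilvermanATAEC1994, Ch. V Lemma 5.2 (c), Thm. 5.3 (a),(b), Cor. 5.4 (held copy PDF pp. 406–410)]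
[cite: NeukirchANT1999, Ch. I §10 (10.3) and Ch. II §9 Prop. (9.6)] -/
theorem phi_natCast_eq_neg_one_of_not_split_of_lineUnramifiedAt [W.IsGloballyMinimal]
    (hp2 : p ≠ 2) (hmult : W.HasMultiplicativeReductionAtPrime p)
    (hns : ¬ W.HasSplitMultiplicativeReductionAtPrime p)
    {Φ₀ : AddSubgroup (geomTorsion W (p : ℤ))} (hΦ : IsRationalLine W p Φ₀)
    (hu : LineUnramifiedAt W p Φ₀)
    {m : ℕ} [NeZero m] (φ : DirichletCharacter (ZMod p) m) (hpm : ¬ p ∣ m)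
    (hφ0 : ∀ (σ : absoluteGaloisGroup ℚ), ∀ P ∈ Φ₀,
      σ • P = (φ ((modNCyclotomicCharacter ℚ m σ : (ZMod m)ˣ) : ZMod m)).val • P) :
    φ (p : ZMod m) = -1 := by
  have hpp := hp.out
  set v : HeightOneSpectrum (𝓞 ℚ) := (Rat.HeightOneSpectrum.primesEquiv).symm ⟨p, hpp⟩ with hvdef
  have hv : (Rat.HeightOneSpectrum.primesEquiv v : ℕ) = p := by
    rw [hvdef, Equiv.apply_symm_apply]
  have hpv : ((p : ℕ) : 𝓞 ℚ) ∈ v.asIdeal := natCast_mem_asIdeal_of_primesEquiv_eq hv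
  obtain ⟨𝔐, h𝔐⟩ := v.localPrimesAbove_nonempty
  obtain ⟨τ, hτ⟩ := IsDedekindDomain.HeightOneSpectrum.exists_isArithFrobAt_localAbsIntegers v h𝔐
  obtain ⟨X, hXcard, hflip, hinert⟩ := CongruentPartnerTrace.exists_line_of_not_split W p
    TateCurve.Silverman1994_thmV53_corV54_tateUniformisation_holds hp2 hmult hns hpv h𝔐 hτ
  have hI₀ : ∀ j ∈ (adicCompletionPrime ℚ v).inertia (absoluteGaloisGroup ℚ),
      ∀ P : geomTorsion W (p : ℤ), j • P - P ∈ X := by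
    intro j hj P
    rw [inertia_adicCompletionPrime_eq_map_absInertia] at hj
    obtain ⟨σ, hσI, rfl⟩ := hj
    exact hinert σ hσI P
  -- `X` is THE Tate line: it has a point moved by `I_{𝔓₀}`
  obtain ⟨L, hLcard, hLI, σ₀, hσ₀, P₀, hP₀, hne₀⟩ :=
    exists_tateLine_adicCompletionPrime_of_mem hp2 hmult hpv
  have hXL : X = L := eq_of_quot_trivial_of_moved hXcard hLcard hI₀ hLI ⟨σ₀, hσ₀, P₀, hne₀⟩
  -- the unramified line meets it trivially
  have hbot : Φ₀ ⊓ X = ⊥ := by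
    rcases TateLineDecomposition.inf_eq_bot_or_eq W p hΦ.1 hXcard with h | h
    · exact h
    · exfalso
      refine hne₀ (hu v hpv _ (adicCompletionPrime_mem_primesAbove ℚ v) σ₀ hσ₀ P₀ ?_)
      rw [h, hXL]; exact hP₀
  -- Frobenius acts on `Φ₀` as `−1` and as `φ(p)`
  set σ₁ : absoluteGaloisGroup ℚ := absGaloisRestrict ℚ (v.adicCompletion ℚ) τ with hσ₁def
  have hχ : ((modNCyclotomicCharacter ℚ m σ₁ : (ZMod m)ˣ) : ZMod m) = (p : ZMod m) :=
    modNCyclotomicCharacter_absGaloisRestrict_frob hv h𝔐 hτ m hpm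
  have hs : ∀ P ∈ Φ₀, σ₁ • P = (-1 : ℤ) • P := fun P hP ↦ by
    have h1 : σ₁ • P + P ∈ (Φ₀ ⊓ X : AddSubgroup _) := ⟨Φ₀.add_mem (hΦ.2 σ₁ P hP) hP, hflip P⟩
    rw [hbot, AddSubgroup.mem_bot] at h1
    rw [neg_one_zsmul]
    exact eq_neg_of_add_eq_zero_left h1
  have hn : ∀ P ∈ Φ₀, σ₁ • P = (φ (p : ZMod m)).val • P := fun P hP ↦ by
    have h := hφ0 σ₁ P hP
    rwa [hχ] at h
  have h := natCast_eq_intCast_of_smul_eq_on_line hΦ.1 hs hn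
  rwa [ZMod.natCast_zmod_val, Int.cast_neg, Int.cast_one] at h

/-- **SPLIT, UNRAMIFIED line: `φ(p) = 1`** (odd `p`). Same data with `p` SPLIT: by
`TateLineDecomposition.fix_or_quot_of_split`, `D_v` fixes `Φ₀` pointwise — then a local Frobenius
gives `φ(p) • P = P` — or acts trivially on `E[p]/Φ₀`; the latter is absurd for an unramified
`Φ₀`: the Tate line `C[p]` (moved by `I_{𝔓₀} ≤ D_v`, inertially trivial quotient) would equal `Φ₀`
(`eq_of_quot_trivial_of_moved`). [cite: GreenbergVatsal2000, §2 pp. 14–15 and p. 28]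
[cite: SilvermanATAEC1994, Ch. V Thm. 3.1 (c),(d) p. 423 and §V.5 Thm. 5.3 (a),(b)]
[cite: NeukirchANT1999, Ch. I §10 (10.3) and Ch. II §9 Prop. (9.6)] -/
theorem phi_natCast_eq_one_of_split_of_lineUnramifiedAt [W.IsGloballyMinimal] (hp2 : p ≠ 2)
    (hsplit : W.HasSplitMultiplicativeReductionAtPrime p)
    {Φ₀ : AddSubgroup (geomTorsion W (p : ℤ))} (hΦ : IsRationalLine W p Φ₀)
    (hu : LineUnramifiedAt W p Φ₀)
    {m : ℕ} [NeZero m] (φ : DirichletCharacter (ZMod p) m) (hpm : ¬ p ∣ m)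
    (hφ0 : ∀ (σ : absoluteGaloisGroup ℚ), ∀ P ∈ Φ₀,
      σ • P = (φ ((modNCyclotomicCharacter ℚ m σ : (ZMod m)ˣ) : ZMod m)).val • P) :
    φ (p : ZMod m) = 1 := by
  have hpp := hp.out
  set v : HeightOneSpectrum (𝓞 ℚ) := (Rat.HeightOneSpectrum.primesEquiv).symm ⟨p, hpp⟩ with hvdef
  have hv : (Rat.HeightOneSpectrum.primesEquiv v : ℕ) = p := by
    rw [hvdef, Equiv.apply_symm_apply]
  have hpv : ((p : ℕ) : 𝓞 ℚ) ∈ v.asIdeal := natCast_mem_asIdeal_of_primesEquiv_eq hv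
  obtain ⟨𝔐, h𝔐⟩ := v.localPrimesAbove_nonempty
  obtain ⟨τ, hτ⟩ := IsDedekindDomain.HeightOneSpectrum.exists_isArithFrobAt_localAbsIntegers v h𝔐
  have hE := TateLineDecomposition.fix_or_quot_of_split W p
    TateCurve.Silverman1994_thmV53_tateUniformisation_holds hsplit hpv hΦ.1
    (fun g _ P hP ↦ hΦ.2 g P hP)
  rcases hE with hfix | hquot
  · set σ₁ : absoluteGaloisGroup ℚ := absGaloisRestrict ℚ (v.adicCompletion ℚ) τ with hσ₁def
    have hσ₁D : σ₁ ∈ decomp (K := ℚ) v := ⟨τ, rfl⟩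
    have hχ : ((modNCyclotomicCharacter ℚ m σ₁ : (ZMod m)ˣ) : ZMod m) = (p : ZMod m) :=
      modNCyclotomicCharacter_absGaloisRestrict_frob hv h𝔐 hτ m hpm
    have hs : ∀ P ∈ Φ₀, σ₁ • P = (1 : ℤ) • P := fun P hP ↦ by
      rw [one_zsmul]; exact hfix σ₁ hσ₁D P hP
    have hn : ∀ P ∈ Φ₀, σ₁ • P = (φ (p : ZMod m)).val • P := fun P hP ↦ by
      have h := hφ0 σ₁ P hP
      rwa [hχ] at h
    have h := natCast_eq_intCast_of_smul_eq_on_line hΦ.1 hs hn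
    rwa [ZMod.natCast_zmod_val, Int.cast_one] at h
  · exfalso
    have hmult : W.HasMultiplicativeReductionAtPrime p := hsplit.hasMultiplicativeReductionAtPrime
    obtain ⟨L, hLcard, hLI, σ₀, hσ₀, P₀, hP₀, hne₀⟩ :=
      exists_tateLine_adicCompletionPrime_of_mem hp2 hmult hpv
    have hΦI : ∀ j ∈ (adicCompletionPrime ℚ v).inertia (absoluteGaloisGroup ℚ),
        ∀ P : geomTorsion W (p : ℤ), j • P - P ∈ Φ₀ := by
      intro j hj P
      rw [inertia_adicCompletionPrime_eq_map_absInertia] at hj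
      exact hquot j (inertia_le_decomp v hj) P
    have hΦL : Φ₀ = L := eq_of_quot_trivial_of_moved hΦ.1 hLcard hΦI hLI ⟨σ₀, hσ₀, P₀, hne₀⟩
    exact hne₀ (hu v hpv _ (adicCompletionPrime_mem_primesAbove ℚ v) σ₀ hσ₀ P₀ (hΦL ▸ hP₀))


end Summit.BirchSwinnertonDyer.BirchSwinnertonDyer.Theorems.EisensteinPrimesLinePhiAtMultiplicativePrime

end
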